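import Summits.ABC.ABC.Theses.FeketeScales
import Summits.ABC.ABC.Theorems.FeketeScalesAssembly
import Summits.ABC.ABC.Theorems.FeketeScalesSubmultOfRST
import Summits.ABC.ABC.Theorems.FeketeScalesPolynomialAbcOfSubmult
import Summits.ABC.ABC.Theorems.FeketeScalesQuasiPolynomialAbcOfEpsSubmult
import Summits.ABC.ABC.Theorems.FeketeScalesTargetOfCruxes
import Summits.ABC.ABC.Theorems.FeketeScalesSparseGoodScalesWindow
import HarnessLib

/-!
# Sibling audit for the SUSPECT-EQUIVALENCE question on `SparseGoodScales` (stmt-ABC-2161) — crux-strategist q1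

Trigger: `Summit.ABC.ABC.Theorems.sparseGoodScales_iff_abc_of_scaleSubmultiplicativity :
ScaleSubmultiplicativity → (SparseGoodScales ↔ ABC)` (Theorems/FeketeScalesSparseGoodScalesWindow.lean:237, p96477).

This file kernel-checks the ANATOMY of that equivalence and prints the axiom closure of every PROVED sibling of the
crux in route `FeketeScales` (items 2165 Assembly, 10340 SubmultOfRST, 2163 PolynomialAbcOfSubmult,
2164 QuasiPolynomialAbcOfEpsSubmult, 14163 TargetOfCruxes).  Companion: `ProbeQ1Min.lean` / `ProbeQ1Landed.lean`
(BC7 `#h21_crux_probe` batteries) and `SIBLING-AUDIT-q1.md` (the verdict).  No new mathematics; standard axioms.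
-/

set_option linter.dupNamespace false

namespace Summit.ABC.ABC.Cruxes.SparseGoodScales.StrategistQ1

open Summit.ABC.ABC.Theses.FeketeScales
open Summit.ABC.ABC.Theorems

/-! ## §1  The trigger is (proved Assembly) ∘ (open sibling) + (trivial calibration) — nothing else -/

/-- The `→` direction of the trigger is LITERALLY the route's Assembly (item stmt-ABC-2165, 383-line Fekete
iteration) applied to the OPEN sibling crux `ScaleSubmultiplicativity`; the `←` direction is the calibration
`ABC → SparseGoodScales` (every large scale is good).  So the equivalence is conditional on an open crux and its
only proved ingredient of substance is the Assembly. [folklore] -/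
theorem trigger_anatomy (hS : ScaleSubmultiplicativity) : SparseGoodScales ↔ _root_.ABC :=
  ⟨fun hG => feketeScales_assembly_proof hS hG, sparseGoodScales_of_abc⟩

/-- The trigger re-derived: it is `trigger_anatomy` (same statement as the landed theorem). [folklore] -/
example : ∀ hS : ScaleSubmultiplicativity,
    (sparseGoodScales_iff_abc_of_scaleSubmultiplicativity hS).mpr = (trigger_anatomy hS).mpr := fun _ => rfl

/-- `Assembly` is by definition the two-hypothesis implication consumed by `closes`. [folklore] -/
example : Assembly = (ScaleSubmultiplicativity → SparseGoodScales → _root_.ABC) := rfl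

/-- `Target` is definitionally the conjunction of the two cruxes (so `closes := h_Assembly h_Target.1 h_Target.2`
consumes BOTH cruxes through the Assembly). [folklore] -/
example : Target ↔ ScaleSubmultiplicativity ∧ SparseGoodScales := Iff.rfl

/-- GENERIC SIGNAL (pure logic; cf. `StrategistR1.regress` of the r1 census): for ANY route of shape
`V → H → S` whose second piece is an `S`-consequence, the conditional equivalence `V → (H ↔ S)` holds.  The trigger
is this lemma with `V := ScaleSubmultiplicativity`, `H := SparseGoodScales`, `S := ABC`,
`assembly := feketeScales_assembly_proof`, `calib := sparseGoodScales_of_abc`; it says nothing about whether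
`V` or the assembly is substantive — that is what the audit below decides. [folklore] -/
theorem generic_signal {V H S : Prop} (assembly : V → H → S) (calib : S → H) : V → (H ↔ S) :=
  fun v => ⟨assembly v, calib⟩

example : ScaleSubmultiplicativity → (SparseGoodScales ↔ _root_.ABC) :=
  generic_signal feketeScales_assembly_proof sparseGoodScales_of_abc

/-! ## §2  What the OPEN sibling buys on its own (substance check of the hypothesis of the trigger)

`ScaleSubmultiplicativity` alone yields POLYNOMIAL abc `∃ A C, c ≤ C·rad^A` (item 2163 + the discharged S-unit
finiteness abc.S25) — an open statement far beyond Stewart–Yu; so the hypothesis under which the crux becomes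
summit-equivalent is itself at least polynomial-abc-hard, not a proved triviality. -/

example (hS : ScaleSubmultiplicativity) :
    ∃ A C : ℝ, ∀ a b c : ℕ, Literature.NumberTheory.DiophantineGeometry.IsABCTriple a b c →
      (c : ℝ) ≤ C * ((Literature.NumberTheory.DiophantineGeometry.rad a b c : ℕ) : ℝ) ^ A :=
  sparseGoodScales_boundedQuality_of_scaleSubmultiplicativity hS

/-! ## §3  Axiom closures of every proved sibling and of the trigger (gate whitelist: propext, Classical.choice,
Quot.sound; no `sorryAx`, no project axioms) -/

#print axioms Summit.ABC.ABC.Theorems.feketeScales_assembly_proof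
#print axioms Summit.ABC.ABC.Theorems.submultOfRST_proof
#print axioms Summit.ABC.ABC.Theorems.polynomialAbcOfSubmult_proof
#print axioms Summit.ABC.ABC.Theorems.quasiPolynomialAbcOfEpsSubmult_proof
#print axioms Summit.ABC.ABC.Theorems.feketeScales_targetOfCruxes_proof
#print axioms Summit.ABC.ABC.Theorems.sparseGoodScales_iff_abc_of_scaleSubmultiplicativity
#print axioms Summit.ABC.ABC.Theorems.sparseGoodScales_of_abc
#print axioms Summit.ABC.ABC.Theses.FeketeScales.closes

end Summit.ABC.ABC.Cruxes.SparseGoodScales.StrategistQ1
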